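import Mathlib
import HarnessLib
import Summits.NavierStokesRegularity.NavierStokesRegularity.Theorems.UnthreadedDoorPoloidalLiouvilleOfVorticityRigidity
import Summits.NavierStokesRegularity.NavierStokesRegularity.Theorems.UnthreadedDoorNetFluxNSSpatialAnalyticity
import Summits.NavierStokesRegularity.NavierStokesRegularity.Theorems.ThreadingFluxCentreJetAnalyticOrder

/-!
# Route `UnthreadedDoor` / `ThreadingFlux`, crux `PoloidalLiouville` (stmt-NavierStokesRegularity-1222), antidynamo v2 skeleton (sha16 `4ebf5683127b`),
# WALL `stub_scalarLiouville`: the one-instant vorticity-rigidity closer (R_ω) is decided by ONE GERM (indeed ONE JET) of the vorticity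

Support file (seat leafhand-ns-unthreadeddoor-3 g15, cell decomp-ns), `--supports stmt-NavierStokesRegularity-1222 --as helper`; theorems only.

The frame-covariant rigidity closer of g14 (`FrameSlot.constant_of_fderiv_curl_skew_slice`, p833794) asks for an infinitesimal symmetry
`D(curl v(t₁))(x)[A(x − x₁)] = A (curl v(t₁) x)` of the vorticity at ONE instant `t₁ < 0` on ALL of `ℝ³`.  The slices of the wall's class
are real-analytic on `ℝ³` (`NetFlux.nsSpatialAnalyticity`, HH-0 of the line `height_head`: Oseen gauge + Guberović 2010), hence so is the
SYMMETRY DEFECT `x ↦ D(curl v(t₁))(x)[A(x − x₁)] − A (curl v(t₁) x)` (`analyticOnNhd_fderiv_curl_skew_defect`), and the identity principle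
localises the hypothesis completely:

* ★ `FrameSlot.constant_of_fderiv_curl_skew_germ` — UNCONDITIONAL: if the defect vanishes on a NEIGHBOURHOOD OF ONE POINT `x₂` (any point, not
  necessarily the centre `x₀` of the spheres nor the axis point `x₁`) at one instant, every slice is spatially constant;
* ★ `FrameSlot.constant_of_fderiv_curl_skew_jet` — the same from the INFINITE JET at one point: all diagonal Taylor terms
  `Dⁿ(defect)(x₂)[y,…,y]` vanish (`AnalyticOrder.eqOn_zero_of_diag_eq_zero`) — the exact interface with the centre-jet sieves of the
  `CentreJet` line (there `x₂ = x₀`, and «non-zonal jet data of the vorticity ≡ 0» is this hypothesis for the axis `A = J_a`, `a` the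
  vorticity-rotation vector at the centre);
* `FrameSlot.curl_eq_zero_of_fderiv_curl_skew_germ` — the wall's currency;
* ★ `FrameSlot.poloidalLiouville_of_vorticityGermRigidity` — BY NAME: the crux `PoloidalLiouville` (exact binders) FOLLOWS from
  **(R_ω^germ) ONE-GERM VORTICITY RIGIDITY** «every flow of the wall's class is irrotational at all negative times, or at SOME instant the
  symmetry defect of its vorticity about SOME axis vanishes near SOME point» — a hypothesis WEAKER than (R_ω) of p833794 (so the reduction is
  stronger), local in space-time, and still immune to the Galilean frame slot;
* `FrameSlot.poloidalLiouville_of_vorticityJetRigidity` — the same below the jet form (R_ω^jet).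

HONEST LABEL: a standard analyticity upgrade of a landed closer (assembly over landed theorems: p833794, HH-0, `AnalyticOrder`); it makes precise
that the whole wall is decided by the germ (jet) of the vorticity at a single space-time point, which is the sharpest form in which a rigidity
statement can close ⟨1222⟩, but it does NOT prove `stub_scalarLiouville`, `PoloidalLiouville` (1222), (R_ω) in any form, or anything about
Navier–Stokes regularity; no summit statement is proved. [folklore]
[cite: KochNadirashviliSereginSverak2009, Thm 5.2 (arXiv:0709.3599 pp. 9–10); Guberovic2010, Thm. 1.1; MajdaBertozziCUP2002, §2.3.3]
-/

noncomputable section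

-- the summit and its single sub-problem share the name (CONVENTIONS §1)
set_option linter.dupNamespace false

open scoped Topology InnerProductSpace RealInnerProductSpace ContDiff
open Filter Set Function Metric MeasureTheory
open Literature.Analysis Literature.Analysis.FluidPDE

namespace Summit.NavierStokesRegularity.NavierStokesRegularity.Theorems.PoloidalLiouville.Antidynamo

open Summit.NavierStokesRegularity.NavierStokesRegularity.Theorems.PoloidalLiouville (constantOfIrrotational)
open Summit.NavierStokesRegularity.NavierStokesRegularity.Theorems.PoloidalLiouville.NetFlux (E3 nsSpatialAnalyticity)

namespace FrameSlot

/-- **The symmetry defect of the vorticity slice is real-analytic.**  For a flow of the wall's class (bounded ancient duality-mild, measurable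
slices, jointly smooth on `(−∞,0) × ℝ³`), every `t₁ < 0`, every axis point `x₁` and every linear `A`, the map
`x ↦ D(curl v(t₁))(x)[A(x − x₁)] − A (curl v(t₁) x)` is real-analytic on `ℝ³` (the slice is analytic by HH-0 `NetFlux.nsSpatialAnalyticity`;
`curl = curlCLM ∘ D`, derivatives of analytic maps are analytic, evaluation is bilinear). [cite: Guberovic2010, Thm. 1.1] -/
theorem analyticOnNhd_fderiv_curl_skew_defect
    (v : ℝ → EuclideanSpace ℝ (Fin 3) → EuclideanSpace ℝ (Fin 3))
    (hB : Literature.Analysis.FluidPDE.IsBoundedAncientMildSolution 1 v)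
    (hm : ∀ t < 0, AEStronglyMeasurable (v t) volume)
    (hsm : ContDiffOn ℝ (⊤ : ℕ∞) (Function.uncurry v) (Set.Iio 0 ×ˢ Set.univ))
    {t₁ : ℝ} (ht₁ : t₁ < 0) (x₁ : EuclideanSpace ℝ (Fin 3))
    (A : EuclideanSpace ℝ (Fin 3) →L[ℝ] EuclideanSpace ℝ (Fin 3)) :
    AnalyticOnNhd ℝ (fun x => fderiv ℝ (curl (v t₁)) x (A (x - x₁)) - A (curl (v t₁) x)) univ := by
  have hv : AnalyticOnNhd ℝ (v t₁) univ := nsSpatialAnalyticity v hB hm hsm t₁ ht₁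
  have hcurl : AnalyticOnNhd ℝ (curl (v t₁)) univ := by
    rw [curl_eq_curlCLM_comp]
    exact curlCLM.comp_analyticOnNhd hv.fderiv
  have hD : AnalyticOnNhd ℝ (fderiv ℝ (curl (v t₁))) univ := hcurl.fderiv
  have hlin : AnalyticOnNhd ℝ (fun x : E3 => A (x - x₁)) univ :=
    A.comp_analyticOnNhd (analyticOnNhd_id.sub analyticOnNhd_const)
  have hpair : AnalyticOnNhd ℝ (fun x : E3 => (fderiv ℝ (curl (v t₁)) x, A (x - x₁))) univ := hD.prod hlin
  have hev : AnalyticOnNhd ℝ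
      (fun p : (E3 →L[ℝ] E3) × E3 => (ContinuousLinearMap.id ℝ (E3 →L[ℝ] E3)) p.1 p.2) univ :=
    (ContinuousLinearMap.id ℝ (E3 →L[ℝ] E3)).analyticOnNhd_bilinear _
  have h1 : AnalyticOnNhd ℝ (fun x : E3 => fderiv ℝ (curl (v t₁)) x (A (x - x₁))) univ :=
    hev.comp hpair (mapsTo_univ _ _)
  exact h1.sub (A.comp_analyticOnNhd hcurl)

/-- ★ **ONE GERM OF INFINITESIMAL AXISYMMETRY OF THE VORTICITY ⇒ CONSTANT SLICES** (unconditional).  Let `v` be a bounded ancient mild solution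
(`ν = 1`, duality class) with measurable slices, jointly smooth on `(−∞,0) × ℝ³`, whose vorticity is tangent to the spheres about `x₀` at all times.
If for ONE `t₁ < 0` there are an axis point `x₁`, a skew linear `A ≠ 0` and a point `x₂` such that the symmetry defect
`D(curl v(t₁))(x)[A (x − x₁)] − A (curl v(t₁) x)` vanishes for `x` NEAR `x₂`, then every slice of `v` is spatially constant
(analyticity of the defect + identity principle on the connected `ℝ³`, then `constant_of_fderiv_curl_skew_slice`).
[cite: KochNadirashviliSereginSverak2009, Thm 5.2 (arXiv:0709.3599 pp. 9–10); Guberovic2010, Thm. 1.1] -/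
theorem constant_of_fderiv_curl_skew_germ
    (v : ℝ → EuclideanSpace ℝ (Fin 3) → EuclideanSpace ℝ (Fin 3)) (x₀ : EuclideanSpace ℝ (Fin 3))
    (hB : Literature.Analysis.FluidPDE.IsBoundedAncientMildSolution 1 v)
    (hm : ∀ t < 0, AEStronglyMeasurable (v t) volume)
    (hsm : ContDiffOn ℝ (⊤ : ℕ∞) (Function.uncurry v) (Set.Iio 0 ×ˢ Set.univ))
    (hun : ∀ t < 0, ∀ x, ⟪x - x₀, curl (v t) x⟫ = 0)
    (h₁ : ∃ t₁ < 0, ∃ (x₁ : EuclideanSpace ℝ (Fin 3)) (A : EuclideanSpace ℝ (Fin 3) →L[ℝ] EuclideanSpace ℝ (Fin 3)),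
      (∀ x, ⟪A x, x⟫ = 0) ∧ A ≠ 0 ∧ ∃ x₂ : EuclideanSpace ℝ (Fin 3),
        (fun x => fderiv ℝ (curl (v t₁)) x (A (x - x₁)) - A (curl (v t₁) x)) =ᶠ[𝓝 x₂] 0) :
    ∀ t < 0, ∃ b : EuclideanSpace ℝ (Fin 3), ∀ x, v t x = b := by
  obtain ⟨t₁, ht₁, x₁, A, hskew, hA0, x₂, hgerm⟩ := h₁
  have han := analyticOnNhd_fderiv_curl_skew_defect v hB hm hsm ht₁ x₁ A
  have hall : ∀ x, fderiv ℝ (curl (v t₁)) x (A (x - x₁)) - A (curl (v t₁) x) = 0 := fun x =>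
    han.eqOn_zero_of_preconnected_of_eventuallyEq_zero isPreconnected_univ (mem_univ x₂) hgerm (mem_univ x)
  exact constant_of_fderiv_curl_skew_slice v x₀ hB hm hsm hun ⟨t₁, ht₁, x₁, A, hskew, hA0, hall⟩

/-- ★ **ONE JET OF INFINITESIMAL AXISYMMETRY OF THE VORTICITY ⇒ CONSTANT SLICES** (unconditional).  Same class; if for ONE `t₁ < 0` there are
an axis point `x₁`, a skew linear `A ≠ 0` and a point `x₂` at which ALL diagonal Taylor terms of the symmetry defect vanish,
`Dⁿ(x ↦ D(curl v(t₁))(x)[A(x − x₁)] − A (curl v(t₁) x))(x₂)[y,…,y] = 0` for every `n` and `y`, then every slice of `v` is spatially constant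
(the defect is analytic, so formally zero ⇒ zero: `AnalyticOrder.eqOn_zero_of_diag_eq_zero`).  With `x₂ = x₀ = x₁` and `A y = a × y` this is
the all-order «zonal vorticity jet at the centre» hypothesis of the centre-jet sieves, at ONE instant.
[cite: KochNadirashviliSereginSverak2009, Thm 5.2 (arXiv:0709.3599 pp. 9–10); Guberovic2010, Thm. 1.1] -/
theorem constant_of_fderiv_curl_skew_jet
    (v : ℝ → EuclideanSpace ℝ (Fin 3) → EuclideanSpace ℝ (Fin 3)) (x₀ : EuclideanSpace ℝ (Fin 3))
    (hB : Literature.Analysis.FluidPDE.IsBoundedAncientMildSolution 1 v)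
    (hm : ∀ t < 0, AEStronglyMeasurable (v t) volume)
    (hsm : ContDiffOn ℝ (⊤ : ℕ∞) (Function.uncurry v) (Set.Iio 0 ×ˢ Set.univ))
    (hun : ∀ t < 0, ∀ x, ⟪x - x₀, curl (v t) x⟫ = 0)
    (h₁ : ∃ t₁ < 0, ∃ (x₁ : EuclideanSpace ℝ (Fin 3)) (A : EuclideanSpace ℝ (Fin 3) →L[ℝ] EuclideanSpace ℝ (Fin 3)),
      (∀ x, ⟪A x, x⟫ = 0) ∧ A ≠ 0 ∧ ∃ x₂ : EuclideanSpace ℝ (Fin 3), ∀ (n : ℕ) (y : EuclideanSpace ℝ (Fin 3)),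
        iteratedFDeriv ℝ n (fun x => fderiv ℝ (curl (v t₁)) x (A (x - x₁)) - A (curl (v t₁) x)) x₂ (fun _ => y) = 0) :
    ∀ t < 0, ∃ b : EuclideanSpace ℝ (Fin 3), ∀ x, v t x = b := by
  obtain ⟨t₁, ht₁, x₁, A, hskew, hA0, x₂, hjet⟩ := h₁
  have han := analyticOnNhd_fderiv_curl_skew_defect v hB hm hsm ht₁ x₁ A
  have hall : ∀ x, fderiv ℝ (curl (v t₁)) x (A (x - x₁)) - A (curl (v t₁) x) = 0 := fun x =>
    AnalyticOrder.eqOn_zero_of_diag_eq_zero han isPreconnected_univ (mem_univ x₂) hjet (mem_univ x)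
  exact constant_of_fderiv_curl_skew_slice v x₀ hB hm hsm hun ⟨t₁, ht₁, x₁, A, hskew, hA0, hall⟩

/-- **… and the vorticity conclusion of the germ closer** (the wall's currency). [cite: KochNadirashviliSereginSverak2009, Thm 5.2 (arXiv:0709.3599 pp. 9–10)] -/
theorem curl_eq_zero_of_fderiv_curl_skew_germ
    (v : ℝ → EuclideanSpace ℝ (Fin 3) → EuclideanSpace ℝ (Fin 3)) (x₀ : EuclideanSpace ℝ (Fin 3))
    (hB : Literature.Analysis.FluidPDE.IsBoundedAncientMildSolution 1 v)
    (hm : ∀ t < 0, AEStronglyMeasurable (v t) volume)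
    (hsm : ContDiffOn ℝ (⊤ : ℕ∞) (Function.uncurry v) (Set.Iio 0 ×ˢ Set.univ))
    (hun : ∀ t < 0, ∀ x, ⟪x - x₀, curl (v t) x⟫ = 0)
    (h₁ : ∃ t₁ < 0, ∃ (x₁ : EuclideanSpace ℝ (Fin 3)) (A : EuclideanSpace ℝ (Fin 3) →L[ℝ] EuclideanSpace ℝ (Fin 3)),
      (∀ x, ⟪A x, x⟫ = 0) ∧ A ≠ 0 ∧ ∃ x₂ : EuclideanSpace ℝ (Fin 3),
        (fun x => fderiv ℝ (curl (v t₁)) x (A (x - x₁)) - A (curl (v t₁) x)) =ᶠ[𝓝 x₂] 0) :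
    ∀ t < 0, ∀ x, curl (v t) x = 0 := by
  intro t ht x
  obtain ⟨b, hb⟩ := constant_of_fderiv_curl_skew_germ v x₀ hB hm hsm hun h₁ t ht
  have hvt : v t = fun _ => b := funext hb
  rw [hvt, curl_eq_curlCLM, fderiv_const_apply, map_zero]

/-- ★ **THE CRUX BELOW (R_ω^germ) ONE-GERM VORTICITY RIGIDITY, BY NAME.**  If every flow of the wall's class (bounded ancient duality-mild, measurable
slices, jointly smooth, vorticity tangent to the spheres about some `x₀`) is EITHER irrotational at all negative times OR has, at SOME instant
`t₁ < 0`, a vorticity slice whose infinitesimal-symmetry defect about SOME axis (`x₁`, skew `A ≠ 0`) vanishes NEAR SOME point `x₂`, then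
`PoloidalLiouville` (stmt-1222; conclusion in the crux's exact binder order).  (R_ω^germ) is weaker than (R_ω) of p833794 (global symmetry at
one instant) and, like it, frame-covariant; OPEN in print. [cite: KochNadirashviliSereginSverak2009, §4, Thm 5.2 (arXiv:0709.3599 pp. 8–10); Guberovic2010, Thm. 1.1] -/
theorem poloidalLiouville_of_vorticityGermRigidity
    (hVR : ∀ (v : ℝ → EuclideanSpace ℝ (Fin 3) → EuclideanSpace ℝ (Fin 3)) (x₀ : EuclideanSpace ℝ (Fin 3)),
      Literature.Analysis.FluidPDE.IsBoundedAncientMildSolution 1 v →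
      (∀ t < 0, AEStronglyMeasurable (v t) volume) →
      ContDiffOn ℝ (⊤ : ℕ∞) (Function.uncurry v) (Set.Iio 0 ×ˢ Set.univ) →
      (∀ t < 0, ∀ x, ⟪x - x₀, curl (v t) x⟫ = 0) →
      (∀ t < 0, ∀ x, curl (v t) x = 0) ∨
        ∃ t₁ < 0, ∃ (x₁ : EuclideanSpace ℝ (Fin 3)) (A : EuclideanSpace ℝ (Fin 3) →L[ℝ] EuclideanSpace ℝ (Fin 3)),
          (∀ x, ⟪A x, x⟫ = 0) ∧ A ≠ 0 ∧ ∃ x₂ : EuclideanSpace ℝ (Fin 3),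
            (fun x => fderiv ℝ (curl (v t₁)) x (A (x - x₁)) - A (curl (v t₁) x)) =ᶠ[𝓝 x₂] 0) :
    ∀ v : ℝ → EuclideanSpace ℝ (Fin 3) → EuclideanSpace ℝ (Fin 3),
      Literature.Analysis.FluidPDE.IsBoundedAncientMildSolution 1 v →
      (∀ t < 0, AEStronglyMeasurable (v t) volume) →
      ContDiffOn ℝ (⊤ : ℕ∞) (Function.uncurry v) (Set.Iio 0 ×ˢ Set.univ) →
      (∃ x₀ : EuclideanSpace ℝ (Fin 3), ∀ t < 0, ∀ x,
        inner ℝ (x - x₀) (Literature.Analysis.FluidPDE.curl (v t) x) = 0) →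
      ∀ t < 0, ∃ b : EuclideanSpace ℝ (Fin 3), ∀ x, v t x = b := by
  intro v hB hm hsm hx₀
  obtain ⟨x₀, hun⟩ := hx₀
  rcases hVR v x₀ hB hm hsm hun with h0 | h1
  · exact constantOfIrrotational v hB hsm h0
  · exact constant_of_fderiv_curl_skew_germ v x₀ hB hm hsm hun h1

/-- **The crux below (R_ω^jet) one-jet vorticity rigidity, by name**: as `poloidalLiouville_of_vorticityGermRigidity`, with the second
alternative replaced by the vanishing of ALL diagonal Taylor terms of the symmetry defect at SOME point at SOME instant.
[cite: KochNadirashviliSereginSverak2009, §4, Thm 5.2 (arXiv:0709.3599 pp. 8–10); Guberovic2010, Thm. 1.1] -/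
theorem poloidalLiouville_of_vorticityJetRigidity
    (hVR : ∀ (v : ℝ → EuclideanSpace ℝ (Fin 3) → EuclideanSpace ℝ (Fin 3)) (x₀ : EuclideanSpace ℝ (Fin 3)),
      Literature.Analysis.FluidPDE.IsBoundedAncientMildSolution 1 v →
      (∀ t < 0, AEStronglyMeasurable (v t) volume) →
      ContDiffOn ℝ (⊤ : ℕ∞) (Function.uncurry v) (Set.Iio 0 ×ˢ Set.univ) →
      (∀ t < 0, ∀ x, ⟪x - x₀, curl (v t) x⟫ = 0) →
      (∀ t < 0, ∀ x, curl (v t) x = 0) ∨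
        ∃ t₁ < 0, ∃ (x₁ : EuclideanSpace ℝ (Fin 3)) (A : EuclideanSpace ℝ (Fin 3) →L[ℝ] EuclideanSpace ℝ (Fin 3)),
          (∀ x, ⟪A x, x⟫ = 0) ∧ A ≠ 0 ∧ ∃ x₂ : EuclideanSpace ℝ (Fin 3), ∀ (n : ℕ) (y : EuclideanSpace ℝ (Fin 3)),
            iteratedFDeriv ℝ n (fun x => fderiv ℝ (curl (v t₁)) x (A (x - x₁)) - A (curl (v t₁) x)) x₂ (fun _ => y) = 0) :
    ∀ v : ℝ → EuclideanSpace ℝ (Fin 3) → EuclideanSpace ℝ (Fin 3),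
      Literature.Analysis.FluidPDE.IsBoundedAncientMildSolution 1 v →
      (∀ t < 0, AEStronglyMeasurable (v t) volume) →
      ContDiffOn ℝ (⊤ : ℕ∞) (Function.uncurry v) (Set.Iio 0 ×ˢ Set.univ) →
      (∃ x₀ : EuclideanSpace ℝ (Fin 3), ∀ t < 0, ∀ x,
        inner ℝ (x - x₀) (Literature.Analysis.FluidPDE.curl (v t) x) = 0) →
      ∀ t < 0, ∃ b : EuclideanSpace ℝ (Fin 3), ∀ x, v t x = b := by
  intro v hB hm hsm hx₀
  obtain ⟨x₀, hun⟩ := hx₀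
  rcases hVR v x₀ hB hm hsm hun with h0 | h1
  · exact constantOfIrrotational v hB hsm h0
  · exact constant_of_fderiv_curl_skew_jet v x₀ hB hm hsm hun h1

end FrameSlot

end Summit.NavierStokesRegularity.NavierStokesRegularity.Theorems.PoloidalLiouville.Antidynamo

end
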